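import Summits.KontsevichZagierPeriods.KontsevichZagierPeriods.Theorems.SoloBlindZetaTwoCharts
import Literature.NumberTheory.Transcendental.MZVSimplexRepProofs
import Literature.NumberTheory.Transcendental.BoxIntegralZetaValues
import HarnessLib

/-!
# `ζ(n)` inside the rules, for every `n ≥ 2`, I: the multiplicative chart

The chart of HEAD PRODUCTS `Φ(x) = (x₀, x₀x₁, x₀x₁x₂, …, x₀⋯x_{n-1})` on `ℝⁿ`:

* `headSet`, `headProd` (`x₀⋯x_{k-1}`, with its recursion, positivity and strict decrease on the
  open box);
* the open unit box `kzOpenBox n = (0,1)ⁿ` (the set of the Literature's box integrals,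
  `ℚ`-semialgebraic) and the Literature's open ordered simplex
  `KZ.openOrderedSimplex n = {1 > t₀ > ⋯ > t_{n-1} > 0}`;
* `boxChart`, its derivative `boxChartDeriv` (product rule, coordinatewise), its LOWER-TRIANGULAR
  Jacobian matrix `boxChartMatrix` and determinant `det DΦ(x) = ∏ᵢ headProd x i`
  (`det_boxChartDeriv`), the partial inverse `boxChartInv` (`tᵢ / t_{i-1}`);
* `exists_boxChart`: `Φ` is a `ℚ`-semialgebraic (polynomial) diffeomorphism of the open box ONTO
  the open ordered simplex with `|det DΦ| = ∏ᵢ headProd x i` — the data of ONE change of variables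
  in Kontsevich–Zagier's rule (2), in every dimension at once.

Part II (`SoloBlindZetaBox`) uses it to prove that Beukers' box `[(0,1)ⁿ, dx/(1 - ∏xᵢ)]` and
Kontsevich's simplex `[Δₙ, ω₀^{n-1}ω₁]` (the Literature's `KZ.mzvRep [n]`) are KZ-equivalent by a
single move, for every `n ≥ 2`.

References: F. Beukers (1979), §2; M. Kontsevich, D. Zagier, *Periods* (2001), §1.1–1.2.
-/

noncomputable section

namespace Summit.KontsevichZagierPeriods.KontsevichZagierPeriods.Theorems

open Set MeasureTheory
open Literature.ModelTheory.ExponentialFields (IsSemialgebraic isSemialgebraic_setOf_eval_pos)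
open MvPolynomial (aeval X)
open Literature.NumberTheory.Transcendental
open Literature.NumberTheory.Transcendental.KZ

namespace SoloBlind

variable {n : ℕ}

/-! ## Head products -/

/-- The index set `{j < k}` of the first `k` coordinates of `Fin n`. -/
def headSet (n k : ℕ) : Finset (Fin n) := Finset.univ.filter fun j : Fin n => (j : ℕ) < k

/-- The head product `x₀ x₁ ⋯ x_{k-1}` (`= ∏ⱼ xⱼ` once `k ≥ n`). -/
def headProd (x : Fin n → ℝ) (k : ℕ) : ℝ := ∏ j ∈ headSet n k, x j

/-- Membership in `headSet`. -/
@[simp] theorem mem_headSet {k : ℕ} {j : Fin n} : j ∈ headSet n k ↔ (j : ℕ) < k := by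
  simp [headSet]

/-- `headSet n 0 = ∅`. -/
theorem headSet_zero : headSet n 0 = ∅ := by
  ext j; simp

/-- `headSet n (k+1) = insert k (headSet n k)` for `k < n`. -/
theorem headSet_succ {k : ℕ} (hk : k < n) :
    headSet n (k + 1) = insert ⟨k, hk⟩ (headSet n k) := by
  ext j
  simp only [mem_headSet, Finset.mem_insert, Fin.ext_iff]
  omega

/-- Removing the top index: `headSet n (i+1) ∖ {i} = headSet n i`. -/
theorem headSet_succ_erase (i : Fin n) : (headSet n ((i : ℕ) + 1)).erase i = headSet n i := by
  ext j
  simp only [Finset.mem_erase, mem_headSet, Ne, Fin.ext_iff]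
  omega

/-- For `k ≥ n` the head set is everything. -/
theorem headSet_of_le {k : ℕ} (hk : n ≤ k) : headSet n k = Finset.univ := by
  ext j
  simp only [mem_headSet, Finset.mem_univ, iff_true]
  exact lt_of_lt_of_le j.2 hk

/-- `headProd x 0 = 1`. -/
@[simp] theorem headProd_zero (x : Fin n → ℝ) : headProd x 0 = 1 := by
  simp [headProd, headSet_zero]

/-- The recursion `headProd x (k+1) = x_k · headProd x k`. -/
theorem headProd_succ (x : Fin n → ℝ) {k : ℕ} (hk : k < n) :
    headProd x (k + 1) = x ⟨k, hk⟩ * headProd x k := by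
  rw [headProd, headSet_succ hk, Finset.prod_insert (by simp)]
  rfl

/-- For `k ≥ n`, `headProd x k = ∏ⱼ xⱼ`. -/
theorem headProd_of_le (x : Fin n → ℝ) {k : ℕ} (hk : n ≤ k) : headProd x k = ∏ j, x j := by
  rw [headProd, headSet_of_le hk]

/-- Head products of positive coordinates are positive. -/
theorem headProd_pos {x : Fin n → ℝ} (hx : ∀ i, 0 < x i) (k : ℕ) : 0 < headProd x k :=
  Finset.prod_pos fun j _ => hx j

/-- Head products of coordinates in `(0,1)` are at most `1`. -/
theorem headProd_le_one {x : Fin n → ℝ} (hx : ∀ i, x i ∈ Ioo (0 : ℝ) 1) (k : ℕ) :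
    headProd x k ≤ 1 :=
  Finset.prod_le_one (fun j _ => (hx j).1.le) fun j _ => (hx j).2.le

/-- Head products of coordinates in `(0,1)` strictly decrease: `headProd x l < headProd x k` for
`k < l ≤ n`. -/
theorem headProd_lt_of_lt {x : Fin n → ℝ} (hx : ∀ i, x i ∈ Ioo (0 : ℝ) 1) {k l : ℕ} (hkl : k < l)
    (hl : l ≤ n) : headProd x l < headProd x k := by
  induction l with
  | zero => exact absurd hkl (Nat.not_lt_zero _)
  | succ l ih =>
    have hln : l < n := by omega
    rw [headProd_succ x hln]
    have hstep : x ⟨l, hln⟩ * headProd x l < headProd x l :=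
      mul_lt_of_lt_one_left (headProd_pos (fun i => (hx i).1) l) (hx ⟨l, hln⟩).2
    rcases Nat.lt_succ_iff_lt_or_eq.mp hkl with h | h
    · exact hstep.trans (ih h hln.le)
    · subst h; exact hstep

/-! ## The open box and the open ordered simplex -/

/-- The open unit box `(0,1)ⁿ` (literally the set of the Literature's box integrals). -/
def kzOpenBox (n : ℕ) : Set (Fin n → ℝ) := {x | ∀ i, x i ∈ Ioo (0 : ℝ) 1}

/-- Membership in the open box, unfolded. -/
theorem mem_kzOpenBox {x : Fin n → ℝ} : x ∈ kzOpenBox n ↔ ∀ i, x i ∈ Ioo (0 : ℝ) 1 := Iff.rfl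

/-- The open box is `ℚ`-semialgebraic (finite intersection of `0 < xᵢ`, `0 < 1 - xᵢ`). -/
theorem isSemialgebraic_kzOpenBox (n : ℕ) : IsSemialgebraic ℚ (kzOpenBox n) := by
  have h : kzOpenBox n = ⋂ i ∈ (Finset.univ : Finset (Fin n)),
      ({x : Fin n → ℝ | 0 < aeval x (X i : MvPolynomial (Fin n) ℚ)} ∩
        {x | 0 < aeval x (1 - X i : MvPolynomial (Fin n) ℚ)}) := by
    ext x
    simp [kzOpenBox, sub_pos]
  rw [h]
  exact IsSemialgebraic.biInter _ _ fun i _ =>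
    (isSemialgebraic_setOf_eval_pos _).inter (isSemialgebraic_setOf_eval_pos _)

/-- The open box is measurable. -/
theorem measurableSet_kzOpenBox (n : ℕ) : MeasurableSet (kzOpenBox n) :=
  IsSemialgebraic.measurableSet_holds (isSemialgebraic_kzOpenBox n)

/-- On the open box (with `n ≥ 1`) the full product lies in `(0,1)`, so `1 - ∏ xᵢ ≠ 0`. -/
theorem one_sub_prod_ne_zero (hn : n ≠ 0) {x : Fin n → ℝ} (hx : x ∈ kzOpenBox n) :
    1 - ∏ i, x i ≠ 0 :=
  (sub_pos.mpr (BoxIntegral.prod_mem_Ioo hn hx).2).ne'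

/-! ## The multiplicative chart `Φ(x)ᵢ = x₀ ⋯ xᵢ` -/

/-- The chart of head products. -/
def boxChart (n : ℕ) (x : Fin n → ℝ) : Fin n → ℝ := fun i => headProd x ((i : ℕ) + 1)

/-- Its derivative: row `i` is `Σ_{j ≤ i} (∏_{l ≤ i, l ≠ j} x_l) dx_j`. -/
def boxChartDeriv (n : ℕ) (x : Fin n → ℝ) : (Fin n → ℝ) →L[ℝ] (Fin n → ℝ) :=
  ContinuousLinearMap.pi fun i : Fin n =>
    ∑ j ∈ headSet n ((i : ℕ) + 1), (∏ l ∈ (headSet n ((i : ℕ) + 1)).erase j, x l) •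
      ContinuousLinearMap.proj (R := ℝ) (φ := fun _ : Fin n => ℝ) j

/-- The Jacobian matrix of the chart (lower triangular). -/
def boxChartMatrix (n : ℕ) (x : Fin n → ℝ) : Matrix (Fin n) (Fin n) ℝ := fun i j =>
  if (j : ℕ) < (i : ℕ) + 1 then ∏ l ∈ (headSet n ((i : ℕ) + 1)).erase j, x l else 0

/-- Coordinates of the chart. -/
@[simp] theorem boxChart_apply (x : Fin n → ℝ) (i : Fin n) :
    boxChart n x i = headProd x ((i : ℕ) + 1) := rfl

/-- The chart is differentiable with the stated derivative (product rule, coordinatewise). -/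
theorem hasFDerivAt_boxChart (x : Fin n → ℝ) : HasFDerivAt (boxChart n) (boxChartDeriv n x) x := by
  unfold boxChart boxChartDeriv headProd
  rw [hasFDerivAt_pi]
  intro i
  exact HasFDerivAt.finsetProd fun j _ => hasFDerivAt_apply j x

/-- The derivative applied to a vector. -/
theorem boxChartDeriv_apply (x v : Fin n → ℝ) (i : Fin n) :
    boxChartDeriv n x v i =
      ∑ j ∈ headSet n ((i : ℕ) + 1), (∏ l ∈ (headSet n ((i : ℕ) + 1)).erase j, x l) * v j := by
  simp [boxChartDeriv]

/-- The matrix of the derivative is the (lower-triangular) Jacobian matrix. -/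
theorem toMatrix_boxChartDeriv (x : Fin n → ℝ) :
    LinearMap.toMatrix' ((boxChartDeriv n x : (Fin n → ℝ) →L[ℝ] (Fin n → ℝ)) :
      (Fin n → ℝ) →ₗ[ℝ] (Fin n → ℝ)) = boxChartMatrix n x := by
  ext i j
  rw [LinearMap.toMatrix'_apply, ContinuousLinearMap.coe_coe, boxChartDeriv_apply]
  simp only [boxChartMatrix, Pi.single_apply, mul_ite, mul_one, mul_zero]
  rw [Finset.sum_ite_eq']
  simp

/-- The Jacobian determinant: `det DΦ(x) = ∏ᵢ headProd x i = ∏ᵢ (x₀⋯x_{i-1})`. -/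
theorem det_boxChartDeriv (x : Fin n → ℝ) :
    (boxChartDeriv n x).det = ∏ i : Fin n, headProd x i := by
  rw [ContinuousLinearMap.det, ← LinearMap.det_toMatrix', toMatrix_boxChartDeriv]
  have htri : (boxChartMatrix n x).BlockTriangular OrderDual.toDual := by
    intro i j hij
    have hij' : (i : ℕ) < j := by simpa using hij
    simp only [boxChartMatrix]
    rw [if_neg (by omega)]
  rw [Matrix.det_of_lowerTriangular _ htri]
  refine Finset.prod_congr rfl fun i _ => ?_
  simp only [boxChartMatrix, Nat.lt_succ_self, if_true]
  rw [headSet_succ_erase]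
  rfl

/-- The previous coordinate `t_{i-1}` (`t_{-1} := 1`). -/
def prevCoord (t : Fin n → ℝ) (i : Fin n) : ℝ :=
  if (i : ℕ) = 0 then 1 else t ⟨(i : ℕ) - 1, lt_of_le_of_lt (Nat.sub_le _ _) i.2⟩

/-- `prevCoord t 0 = 1`. -/
theorem prevCoord_of_eq_zero (t : Fin n → ℝ) {i : Fin n} (hi : (i : ℕ) = 0) :
    prevCoord t i = 1 := by
  simp [prevCoord, hi]

/-- `prevCoord t (k+1) = t_k`. -/
theorem prevCoord_succ (t : Fin n → ℝ) {k : ℕ} (hk : k + 1 < n) :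
    prevCoord t ⟨k + 1, hk⟩ = t ⟨k, by omega⟩ := by
  simp [prevCoord]

/-- The partial inverse `Ψ(t)ᵢ = tᵢ / t_{i-1}` (`t_{-1} := 1`). -/
def boxChartInv (n : ℕ) (t : Fin n → ℝ) : Fin n → ℝ := fun i => t i / prevCoord t i

/-- `Ψ ∘ Φ = id` on points with non-zero coordinates. -/
theorem boxChartInv_boxChart {x : Fin n → ℝ} (hx : ∀ i, x i ≠ 0) :
    boxChartInv n (boxChart n x) = x := by
  have hne : ∀ k, headProd x k ≠ 0 := fun k => Finset.prod_ne_zero_iff.mpr fun j _ => hx j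
  funext i
  simp only [boxChartInv]
  rw [boxChart_apply, headProd_succ x i.2]
  rcases Nat.eq_zero_or_eq_succ_pred (i : ℕ) with hi | hi
  · rw [prevCoord_of_eq_zero _ hi, div_one]
    have h2 : headProd x (i : ℕ) = 1 := by rw [hi, headProd_zero]
    rw [h2, mul_one]
  · have hlt : (i : ℕ) - 1 + 1 < n := by omega
    have hi' : i = ⟨(i : ℕ) - 1 + 1, hlt⟩ := Fin.ext (by simp; omega)
    rw [hi', prevCoord_succ, boxChart_apply]
    exact mul_div_cancel_right₀ _ (hne _)

/-- `Φ ∘ Ψ = id` on points with non-zero coordinates. -/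
theorem boxChart_boxChartInv {t : Fin n → ℝ} (ht : ∀ i, t i ≠ 0) :
    boxChart n (boxChartInv n t) = t := by
  have key : ∀ k (hk : k < n), headProd (boxChartInv n t) (k + 1) = t ⟨k, hk⟩ := by
    intro k
    induction k with
    | zero =>
      intro hk
      rw [headProd_succ _ hk, headProd_zero, mul_one]
      show t ⟨0, hk⟩ / prevCoord t ⟨0, hk⟩ = t ⟨0, hk⟩
      rw [prevCoord_of_eq_zero t rfl, div_one]
    | succ k ih =>
      intro hk
      rw [headProd_succ _ hk, ih (by omega)]
      show t ⟨k + 1, hk⟩ / prevCoord t ⟨k + 1, hk⟩ * t ⟨k, _⟩ = t ⟨k + 1, hk⟩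
      rw [prevCoord_succ]
      exact div_mul_cancel₀ _ (ht _)
  funext i
  exact key i i.2

/-- The chart maps the open box into the open ordered simplex. -/
theorem boxChart_mem {x : Fin n → ℝ} (hx : x ∈ kzOpenBox n) :
    boxChart n x ∈ openOrderedSimplex n := by
  have hx0 : ∀ i, 0 < x i := fun i => (hx i).1
  refine ⟨fun i => headProd_pos hx0 _, fun i => ?_, fun i j hij => ?_⟩
  · rw [boxChart_apply, headProd_succ x i.2]
    exact (mul_lt_of_lt_one_left (headProd_pos hx0 _) (hx i).2).trans_le (headProd_le_one hx _)
  · simp only [boxChart_apply]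
    exact headProd_lt_of_lt hx (Nat.succ_lt_succ hij) (by omega)

/-- The partial inverse maps the open ordered simplex into the open box. -/
theorem boxChartInv_mem {t : Fin n → ℝ} (ht : t ∈ openOrderedSimplex n) :
    boxChartInv n t ∈ kzOpenBox n := by
  obtain ⟨h0, h1, hanti⟩ := ht
  intro i
  show t i / prevCoord t i ∈ Ioo (0 : ℝ) 1
  rcases Nat.eq_zero_or_eq_succ_pred (i : ℕ) with hi | hi
  · rw [prevCoord_of_eq_zero _ hi, div_one]
    exact ⟨h0 i, h1 i⟩
  · have hlt : (i : ℕ) - 1 + 1 < n := by omega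
    have hi' : i = ⟨(i : ℕ) - 1 + 1, hlt⟩ := Fin.ext (by simp; omega)
    rw [hi', prevCoord_succ]
    have hlt' : t ⟨(i : ℕ) - 1 + 1, hlt⟩ < t ⟨(i : ℕ) - 1, by omega⟩ :=
      hanti (by simp [Fin.lt_def])
    exact ⟨div_pos (h0 _) (h0 _), (div_lt_one (h0 _)).mpr hlt'⟩

/-- **The multiplicative chart.** `Φ(x)ᵢ = x₀⋯xᵢ` is a `ℚ`-semialgebraic (indeed polynomial)
diffeomorphism of the open box ONTO the open ordered simplex with
`|det DΦ(x)| = ∏ᵢ headProd x i`. -/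
theorem exists_boxChart (n : ℕ) :
    IsSemialgebraicMapOn ℚ (kzOpenBox n) (boxChart n) ∧
      (∀ x ∈ kzOpenBox n, HasFDerivAt (boxChart n) (boxChartDeriv n x) x) ∧
      InjOn (boxChart n) (kzOpenBox n) ∧ boxChart n '' kzOpenBox n = openOrderedSimplex n ∧
      ∀ x ∈ kzOpenBox n, |(boxChartDeriv n x).det| = ∏ i : Fin n, headProd x i := by
  refine ⟨?_, fun x _ => hasFDerivAt_boxChart x, ?_, ?_, fun x hx => ?_⟩
  · convert isSemialgebraicMapOn_aeval (isSemialgebraic_kzOpenBox n)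
      (fun i : Fin n => ∏ j ∈ headSet n ((i : ℕ) + 1), (X j : MvPolynomial (Fin n) ℚ))
      using 2 with x
    funext i
    simp [headProd, map_prod]
  · intro x hx y hy hxy
    have h := congrArg (boxChartInv n) hxy
    rwa [boxChartInv_boxChart (fun i => (hx i).1.ne'), boxChartInv_boxChart (fun i => (hy i).1.ne')]
      at h
  · refine Subset.antisymm (image_subset_iff.mpr fun x hx => boxChart_mem hx) fun t ht => ?_
    exact ⟨boxChartInv n t, boxChartInv_mem ht, boxChart_boxChartInv fun i => (ht.1 i).ne'⟩
  · rw [det_boxChartDeriv]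
    exact abs_of_pos (Finset.prod_pos fun i _ => headProd_pos (fun j => (hx j).1) _)

end SoloBlind

end Summit.KontsevichZagierPeriods.KontsevichZagierPeriods.Theorems
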